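import Summits.ResolutionOfSingularities.ResolutionOfSingularities.Theorems.FrobeniusLadderFInjectiveMacaulayficationSigma3P2d4BNewtonKCoverRecords
import Summits.ResolutionOfSingularities.ResolutionOfSingularities.Theorems.FrobeniusLadderFInjectiveMacaulayficationSigma3P2d4BNewtonKFanChecks
import Summits.ResolutionOfSingularities.ResolutionOfSingularities.Theorems.FrobeniusLadderFInjectiveMacaulayficationFanCheckChunks
import Mathlib.Tactic.IntervalCases
import HarnessLib

/-!
# KERNEL CHECKS (cover records) of the class-route cover data for P2d4B shifted, f′ = σ₃(f_P2d4B) = z² + x²z + x⁵ + x⁶ + y³ + u³ + t⁵ (f_P2d4B = z² + x²z + y³ + u³ + t⁵ = census row #3ʼs bed, σ₃ : z ↦ z + x³, char 2): the sparse multi-vertex cover records, ONE `decide +kernel` per block `j` of the product table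
# (crux `FInjectiveMacaulayfication` stmt-ResolutionOfSingularities-15315, chain w45a; (W-WND) class-route coverage programme, res-L1-w45a-plan-1 RULING R22.14 (2); seat res-L1-w45a-stub-2 g11)

Support file for crux stmt-ResolutionOfSingularities-15315 (`FrobeniusLadder.FInjectiveMacaulayfication`), chain w45a.
[OURS · L1 W4.5a] — NOT a statement of any manuscript; AI-written, weaker than expert review.

`FanCheckChunks.checkHcovMultiL 5 (blockGens KL2 j) MV2 50 131 (RLMB j)` for `j = 0,…,4` (block `j` = the 478 generators `b + e_j`, records `RLM2_j` of `Sigma3P2d4BNewtonKCoverRecords`,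
certificate `P2d4Bs3_cover.json` ba1c76e523070ca0; `Σ cnt ≤ 78571350`), and the `∀ j < 5` form consumed by `FanCheckChunks.hcov_of_blocks`. No definitions, no named facts. [folklore]
-/

-- single-problem summit: the doubled namespace component is forced
set_option linter.dupNamespace false

namespace Summit.ResolutionOfSingularities.ResolutionOfSingularities.Theorems.FInjectiveMacaulayfication.Sigma3P2d4BNewtonKFan

open Summit.ResolutionOfSingularities.ResolutionOfSingularities.Theorems.FInjectiveMacaulayfication
open FanCheckKit FanCheckSound FanCheckChunks

/-- Cover records, block 0 (`b + e_0`), with the specimen-distinct conjunct `CL.length = 131`. -/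
theorem check_hcov_0 : checkHcovMultiL 5 (blockGens KL2 0) MV2 50 131 (RLMB 0) = true ∧ CL.length = 131 := ⟨by decide +kernel, tlen⟩

/-- Cover records, block 1 (`b + e_1`), with the specimen-distinct conjunct `CL.length = 131`. -/
theorem check_hcov_1 : checkHcovMultiL 5 (blockGens KL2 1) MV2 50 131 (RLMB 1) = true ∧ CL.length = 131 := ⟨by decide +kernel, tlen⟩

/-- Cover records, block 2 (`b + e_2`), with the specimen-distinct conjunct `CL.length = 131`. -/
theorem check_hcov_2 : checkHcovMultiL 5 (blockGens KL2 2) MV2 50 131 (RLMB 2) = true ∧ CL.length = 131 := ⟨by decide +kernel, tlen⟩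

/-- Cover records, block 3 (`b + e_3`), with the specimen-distinct conjunct `CL.length = 131`. -/
theorem check_hcov_3 : checkHcovMultiL 5 (blockGens KL2 3) MV2 50 131 (RLMB 3) = true ∧ CL.length = 131 := ⟨by decide +kernel, tlen⟩

/-- Cover records, block 4 (`b + e_4`), with the specimen-distinct conjunct `CL.length = 131`. -/
theorem check_hcov_4 : checkHcovMultiL 5 (blockGens KL2 4) MV2 50 131 (RLMB 4) = true ∧ CL.length = 131 := ⟨by decide +kernel, tlen⟩

/-- ★ All five block checks, in the `∀ j < 5` shape of `FanCheckChunks.hcov_of_blocks` (with the specimen-distinct conjunct). -/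
theorem check_hcov : (∀ j < 5, checkHcovMultiL 5 (blockGens KL2 j) MV2 50 131 (RLMB j) = true) ∧ CL.length = 131 := by
  refine ⟨fun j hj => ?_, tlen⟩
  interval_cases j
  · exact check_hcov_0.1
  · exact check_hcov_1.1
  · exact check_hcov_2.1
  · exact check_hcov_3.1
  · exact check_hcov_4.1

end Summit.ResolutionOfSingularities.ResolutionOfSingularities.Theorems.FInjectiveMacaulayfication.Sigma3P2d4BNewtonKFan
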